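/-
Copyright (c) 2026 the pub-hodgecm-mathlib formalisation cell (harness21).  Prover seat hodgecm-mathlib-K2E4-p11 (g8): Track B «K2-LIT»,
#184♮ = hLiu418 = stmt-HodgeConjecture-24832; socket #41 open surface (u-0c), I4 block (desk of record): the CONSTRUCTIBLE datum letters `Γ₀ hΓ₀ β₁ hβ₁` of
★ p862751 I4 ED. 5 `exists_middleTerm_package_of_standard_level` — a covering weight for the stabiliser lattice of the middle reflection.
THEOREMS ONLY (no `def`, no `instance`, no `notation`, no named-fact hypothesis, no `sorry`).
-/
import Summits.HodgeConjecture.HodgeConjecture.Theorems.K2LiuSiegelEisensteinCoeffOrbitSum   -- ★ `exists_stabilizer_subgroup`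
import Summits.HodgeConjecture.HodgeConjecture.Theorems.K2LiuSiegelDoubledUnfold            -- ★ `exists_isCoveringWeight_ratH` (second countability of `H(𝔸)`, discreteness of `H(L⁺)` by import)
import Literature.NumberTheory.Automorphic.UnitaryGroupRationalDiscrete                       -- ★ `discreteTopology_range_toAdelic`
import HarnessLib

/-!
# Crux `HLiu418`, socket #41, (u-0c) I4 block — `K2LiuSiegelMiddleTermStabilizerWeight`: A COVERING WEIGHT FOR A LATTICE OF RATIONAL UNIPOTENTS, AND THE STABILISER DATUM
# `Γ₀ hΓ₀ β₁ hβ₁` OF THE MIDDLE TERM, CONSTRUCTED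

Cell `hodgecm-mathlib`, crux item hLiu418 = `stmt-HodgeConjecture-24832`; squad K2 ∕ K2Liu (L1, LEAD F0P6-plan (g14)), road `K2_Liu`, socket #41, (u-0c) I4 block
(K2E4-p11 desk of record; consumer: the TOP's tie of ★ p862751 I4 ED. 5, whose visible datum letters `Γ₀ hΓ₀ β₁ hβ₁` are existential here).  Lane
`--supports stmt-HodgeConjecture-24832 --as helper` (count-neutral helper; closes no socket by itself).

THE MATHEMATICS [MoeglinWaldspurger1995, II.1.6–II.1.7], [Borel1963, §1.2], [Garrett2018, §1.8].  A subgroup `Γ₀ ≤ N_Δ(𝔸)` all of whose elements are `L⁺`-rational is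
DISCRETE (`H(L⁺)` is discrete in `H(𝔸)`, ★ `discreteTopology_range_toAdelic`), so it admits a covering weight on the second countable group `N_Δ(𝔸)` (the indicator of a
strict measurable fundamental domain, ★ `exists_isCoveringWeight`) — §1 `exists_isCoveringWeight_of_forall_mem_ratH`; with ★ `exists_stabilizer_subgroup` (the stabiliser
`Γ₀ = {u ∈ N_Δ(L⁺) | γ₀ u γ₀⁻¹ ∈ P_Δ}` of a rational `γ₀` as a `Subgroup`) this CONSTRUCTS the stabiliser datum of the middle term: §2 **`exists_stabilizer_coveringWeight`**
(`Γ₀`, its membership law `hΓ₀` VERBATIM as in ★ α3-2 ∕ ★ I4 ED. 5, and a `Γ₀`-covering weight `β₁`) — at the middle reflection `γ₀ = w₀ = ι(1, g₀ ⊗ 1)` (★ `iotaGG_one_mem_ratH`).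
HONEST LABEL.  Count-neutral helper; it retires nothing by itself: `HC_CM` is proved only modulo the 7 printed citations (2 remaining named inputs:
hLiu418 = `stmt-HodgeConjecture-24832`, h413 = `stmt-HodgeConjecture-24833`) until rung 0 closes.

## References
* [MoeglinWaldspurger1995] C. Mœglin, J.-L. Waldspurger, *Spectral decomposition and Eisenstein series* (1995), II.1.6–II.1.7.
* [Borel1963] A. Borel, *Some finiteness properties of adele groups over number fields*, Publ. IHÉS 16 (1963), §1.2.
* [Garrett2018] P. Garrett, *Modern analysis of automorphic forms by example* (2018), §1.8.
-/

set_option autoImplicit false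
set_option linter.dupNamespace false -- the mandated namespace repeats `HodgeConjecture.HodgeConjecture`

noncomputable section

open scoped Matrix ENNReal NNReal
open NumberField IsDedekindDomain MeasureTheory
open Literature.NumberTheory.Automorphic Literature.NumberTheory.Automorphic.UnitaryGroup
open Literature.NumberTheory.GelbartRogawski1991 Literature.NumberTheory.GelbartRogawski1991.GRConstruction
open Literature.NumberTheory.K2Lit.SiegelDoubled Literature.MeasureTheory.Group
open Summit.HodgeConjecture.HodgeConjecture.Cruxes.HLiu418.K2LiuSiegelEisensteinCoeffOrbitSum (exists_stabilizer_subgroup)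

namespace Summit.HodgeConjecture.HodgeConjecture.Cruxes.HLiu418.K2LiuSiegelMiddleTermStabilizerWeight

variable (L : Type) [Field L] [NumberField L] [IsCMField L]
variable {N M n : ℕ} (e : Fin N × Fin M ≃ Fin n)
  (dV : Fin N → L) (hdV : ∀ i, IsCMField.complexConj L (dV i) = dV i)
  (dW : Fin M → L) (hdW : ∀ i, IsCMField.complexConj L (dW i) = dW i)
variable [MeasurableSpace (unipDelta L e dV hdV dW hdW)] [BorelSpace (unipDelta L e dV hdV dW hdW)]

/-! ## §1 A covering weight for a subgroup of rational unipotents -/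

/-- **A SUBGROUP OF `N_Δ(𝔸)` CONSISTING OF `L⁺`-RATIONAL ELEMENTS HAS A COVERING WEIGHT**: it is discrete (★ `discreteTopology_range_toAdelic`: `H(L⁺)` is discrete in
`H(𝔸)`; a continuous injection into a discrete space has discrete source), and `N_Δ(𝔸)` is second countable, so ★ `exists_isCoveringWeight` applies.
[cite: MoeglinWaldspurger1995, II.1.6] [cite: Borel1963, §1.2] [cite: Garrett2018, §1.8] -/
theorem exists_isCoveringWeight_of_forall_mem_ratH (Γ₀ : Subgroup (unipDelta L e dV hdV dW hdW))
    (hrat : ∀ u ∈ Γ₀, ((u : unipDelta L e dV hdV dW hdW) : HA L e dV hdV dW hdW) ∈ ratH L e dV hdV dW hdW) :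
    ∃ β₁ : unipDelta L e dV hdV dW hdW → ℝ≥0∞, IsCoveringWeight Γ₀ β₁ := by
  haveI : DiscreteTopology (ratH L e dV hdV dW hdW) :=
    discreteTopology_range_toAdelic (Fp L) L (IsCMField.complexConj L) (n + n) (hermD L e dV hdV dW hdW)
  haveI : DiscreteTopology Γ₀ := by
    refine DiscreteTopology.of_continuous_injective
      (f := fun u : Γ₀ => (⟨((u : unipDelta L e dV hdV dW hdW) : HA L e dV hdV dW hdW), hrat u u.2⟩ : ratH L e dV hdV dW hdW)) ?_ ?_
    · exact (continuous_subtype_val.comp continuous_subtype_val).subtype_mk _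
    · intro a b h
      have h' := congrArg (fun x : ratH L e dV hdV dW hdW => (x : HA L e dV hdV dW hdW)) h
      exact Subtype.ext (Subtype.ext h')
  haveI : SecondCountableTopology (HA L e dV hdV dW hdW) := inferInstance
  haveI : SecondCountableTopology (unipDelta L e dV hdV dW hdW) := TopologicalSpace.Subtype.secondCountableTopology _
  exact exists_isCoveringWeight Γ₀

/-! ## §2 The stabiliser datum `Γ₀ hΓ₀ β₁ hβ₁` of the middle term, constructed -/

/-- **THE STABILISER DATUM OF A RATIONAL ELEMENT, CONSTRUCTED**: for `γ₀ ∈ H(L⁺)` there are a subgroup `Γ₀ ≤ N_Δ(𝔸)` with the membership law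
`u ∈ Γ₀ ↔ u ∈ H(L⁺) ∧ γ₀ u γ₀⁻¹ ∈ P_Δ(𝔸)` (★ `exists_stabilizer_subgroup`) AND a `Γ₀`-covering weight `β₁` (§1) — the letters `Γ₀ hΓ₀ β₁ hβ₁` of ★ α3-2 ∕ ★ I4 ED. 5 at
`γ₀ := w₀ = ι(1, g₀ ⊗ 1)` (rational by ★ `iotaGG_one_mem_ratH`). [cite: MoeglinWaldspurger1995, II.1.6–II.1.7] [cite: Garrett2018, §1.8] -/
theorem exists_stabilizer_coveringWeight (γ₀ : ratH L e dV hdV dW hdW) :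
    ∃ (Γ₀ : Subgroup (unipDelta L e dV hdV dW hdW)) (β₁ : unipDelta L e dV hdV dW hdW → ℝ≥0∞),
      (∀ u : unipDelta L e dV hdV dW hdW, u ∈ Γ₀ ↔ (u : HA L e dV hdV dW hdW) ∈ ratH L e dV hdV dW hdW ∧
        IsSiegelDelta L e dV hdV dW hdW ((γ₀ : HA L e dV hdV dW hdW) * (u : HA L e dV hdV dW hdW) * ((γ₀ : HA L e dV hdV dW hdW))⁻¹)) ∧
      IsCoveringWeight Γ₀ β₁ := by
  obtain ⟨Γ₀, hΓ₀⟩ := exists_stabilizer_subgroup (L := L) (e := e) (dV := dV) (hdV := hdV) (dW := dW) (hdW := hdW) γ₀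
  obtain ⟨β₁, hβ₁⟩ := exists_isCoveringWeight_of_forall_mem_ratH L e dV hdV dW hdW Γ₀ fun u hu => ((hΓ₀ u).1 hu).1
  exact ⟨Γ₀, β₁, hΓ₀, hβ₁⟩

end Summit.HodgeConjecture.HodgeConjecture.Cruxes.HLiu418.K2LiuSiegelMiddleTermStabilizerWeight

end
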